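import Literature.NumberTheory.EllipticCurves.RankinSelbergWeightOneIdentity
import Literature.NumberTheory.EllipticCurves.EisensteinWeightOneDomainBounds
import Literature.NumberTheory.EllipticCurves.Gamma0EisensteinWeightOneQExpansion
import Literature.NumberTheory.EllipticCurves.Gamma0CuspFormQSeriesBounds
import Mathlib.Analysis.Normed.Ring.Finite
import HarnessLib

/-!
# The Rankin–Selberg integral of a weight-`2` cusp form against a weight-one Eisenstein series:
the Dirichlet series on `Re s ≫ 0` and its continuation to `s = 0`

Topic `Literature/NumberTheory/EllipticCurves`; namespace
`Literature.NumberTheory.EllipticCurves.ModularForms`. One definition with a body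
(`eisensteinOneZeroCoeff`, the `q`-coefficients of Hecke's holomorphic weight-one Eisenstein series
`G̃_χ(·, 0)`) and theorems; no named fact.

Data: `χ` a primitive odd Dirichlet character mod `M`, `M ∣ N`, `f ∈ S₂(Γ₀(N))` with coefficients
`a(m) = cuspCoeff f m`, `ψ = χ⁻¹` viewed mod `N`, `F = G̃_χ(·, 0)` (weight `1`, character `ψ` on
`Γ₀(N)`, `q`-coefficients `b = eisensteinOneZeroCoeff χ`: `b(0) = 2L(χ, 1)`,
`b(m) = -(4πi τ(χ)/M) Σ_{d ∣ m} χ̄(d)`), and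

`J(s) = ∫_F \overline{G̃_ψ(τ, s̄)} f(τ) \overline{F(τ)} (Im τ)² dμ`, `F = ⋃_q g_q⁻¹ 𝒟ᵒ`.

* `eisensteinOneCont_zero_eq_qSeries` — `G̃_χ(·, 0) = qSeries b` (the `q`-expansion of
  `Gamma0EisensteinWeightOneQExpansion` repackaged), with `norm_eisensteinOneZeroCoeff_le`;
* `eisensteinOneCont_zero_smul_of_dvd`, `odd_changeLevel_inv` — `F(Aτ) = ψ(d) j(A, τ) F(τ)` for
  `A ∈ Γ₀(N)`, and `ψ` is odd;
* `rankinSelberg_eisensteinPair_eq_tsum` — **for `Re s > σ₀`: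
  `J(s) = \overline{L(ψ, 1+2s̄)} · 2Γ(s+1) Σ_{m ≥ 1} a(m) \overline{b(m)} (4πm)^{-(s+1)}`**
  (`RankinSelbergWeightOneIdentity` with every hypothesis discharged: `q`-expansions and coefficient
  bounds, the global growth bounds of `Gamma0CuspFormQSeriesBounds` and
  `EisensteinWeightOneDomainBounds`, automorphy);
* `rankinSelberg_eisensteinPair_continuation` — **`J` is the holomorphic continuation to
  `Re s > -1/2` of that Dirichlet series**: any `G` holomorphic on `Re s > -1/2` agreeing with the
  right-hand side for `Re s > σ₀` equals `J` there; in particular (`rankinSelberg_eisensteinPair_zero`)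
  `G(0) = ∫_F \overline{G̃_ψ(τ, 0)} f(τ) \overline{G̃_χ(τ, 0)} (Im τ)² dμ`, a Petersson-type pairing
  of `f` with the product of two holomorphic weight-one Eisenstein series.

This is the analytic half ("PART A") of the Rankin–Selberg/Gross route to the central values
`L(f, 1) L(f ⊗ χ̄, 1)` (Rankin 1939, §4; Shimura 1976, §2; Gross 1987, §§4–5): by the Rankin
factorisation (`Literature.NumberTheory.LFunctions.RankinEisensteinFactorisation`) the Dirichlet
series is `L(f, s+1) L(f ⊗ χ̄, s+1)/L(χ̄_N, 2s+1)` up to the constant `-\overline{4πiτ(χ)}/M` when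
`f` is a normalised Hecke eigenform. Everything here is proved. [folklore]

## References

* R. A. Rankin, Proc. Cambridge Philos. Soc. 35 (1939), 357–372, §4.
* G. Shimura, Comm. Pure Appl. Math. 29 (1976), 783–804, §2.
* B. H. Gross, *Heights and the special values of L-series*, CMS Conf. Proc. 7 (1987), §§4–5.
-/

noncomputable section

open scoped MatrixGroups ModularForm Modular ENNReal NNReal ComplexConjugate Real Topology
open MeasureTheory Set Filter ModularGroup CongruenceSubgroup Complex
open UpperHalfPlane hiding I

namespace Literature.NumberTheory.EllipticCurves.ModularForms

/-! ### The `q`-coefficients of `G̃_χ(·, 0)` -/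

section Coeff

variable {M : ℕ} [NeZero M] (χ : DirichletCharacter ℂ M)

/-- The `q`-coefficients of Hecke's holomorphic weight-one Eisenstein series `G̃_χ(·, 0)`:
`b(0) = 2 L(χ, 1)` and `b(m) = -(4πi τ(χ)/M) Σ_{d ∣ m} χ̄(d)` for `m ≥ 1` (`τ(χ)` the Gauss sum
for the standard additive character). [folklore] -/
def eisensteinOneZeroCoeff (m : ℕ) : ℂ :=
  if m = 0 then 2 * χ.LFunction 1
  else -(4 * π * Complex.I * gaussSum χ (ZMod.stdAddChar (N := M)) / M) *
    ∑ d ∈ m.divisors, χ⁻¹ (d : ZMod M)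

/-- The trivial bound `|τ(χ)| ≤ M`. [folklore] -/
theorem norm_gaussSum_stdAddChar_le : ‖gaussSum χ (ZMod.stdAddChar (N := M))‖ ≤ M := by
  unfold gaussSum
  calc ‖∑ a : ZMod M, χ a * ZMod.stdAddChar a‖
      ≤ ∑ a : ZMod M, ‖χ a * ZMod.stdAddChar a‖ := norm_sum_le _ _
    _ ≤ ∑ _a : ZMod M, (1 : ℝ) := Finset.sum_le_sum fun a _ => by
        rw [norm_mul, AddChar.norm_apply, mul_one]
        exact χ.norm_le_one a
    _ = M := by simp

omit [NeZero M] in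
/-- `|Σ_{d ∣ m} χ̄(d)| ≤ m + 1`. [folklore] -/
theorem norm_sum_divisors_inv_le (m : ℕ) :
    ‖∑ d ∈ m.divisors, χ⁻¹ (d : ZMod M)‖ ≤ (m : ℝ) + 1 := by
  calc ‖∑ d ∈ m.divisors, χ⁻¹ (d : ZMod M)‖ ≤ ∑ d ∈ m.divisors, ‖χ⁻¹ (d : ZMod M)‖ :=
        norm_sum_le _ _
    _ ≤ ∑ _d ∈ m.divisors, (1 : ℝ) := Finset.sum_le_sum fun d _ => χ⁻¹.norm_le_one _
    _ = m.divisors.card := by simp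
    _ ≤ m := by exact_mod_cast Nat.card_divisors_le_self m
    _ ≤ (m : ℝ) + 1 := by linarith

/-- **Polynomial bound on the coefficients**: `|b(m)| ≤ (2|L(χ, 1)| + 4π) (m+1)²`. [folklore] -/
theorem norm_eisensteinOneZeroCoeff_le (m : ℕ) :
    ‖eisensteinOneZeroCoeff χ m‖ ≤ (2 * ‖χ.LFunction 1‖ + 4 * π) * ((m : ℝ) + 1) ^ 2 := by
  have hM : (0 : ℝ) < M := by exact_mod_cast Nat.pos_of_ne_zero (NeZero.ne M)
  have hm0 : (0 : ℝ) ≤ m := Nat.cast_nonneg m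
  have h1 : (1 : ℝ) ≤ ((m : ℝ) + 1) ^ 2 := one_le_pow₀ (by linarith)
  have hL : 0 ≤ ‖χ.LFunction 1‖ := norm_nonneg _
  unfold eisensteinOneZeroCoeff
  split_ifs with hm
  · rw [norm_mul, Complex.norm_ofNat]
    nlinarith [Real.pi_pos]
  · rw [norm_mul, norm_neg, norm_div, norm_mul, norm_mul, norm_mul, Complex.norm_ofNat,
      Complex.norm_real, Real.norm_of_nonneg Real.pi_pos.le, Complex.norm_I, mul_one,
      Complex.norm_natCast]
    have hg := norm_gaussSum_stdAddChar_le χ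
    have hc : 4 * π * ‖gaussSum χ (ZMod.stdAddChar (N := M))‖ / M ≤ 4 * π := by
      rw [div_le_iff₀ hM]
      nlinarith [Real.pi_pos, norm_nonneg (gaussSum χ (ZMod.stdAddChar (N := M)))]
    have hs := norm_sum_divisors_inv_le χ m
    have h2 : (m : ℝ) + 1 ≤ ((m : ℝ) + 1) ^ 2 := by nlinarith
    calc 4 * π * ‖gaussSum χ (ZMod.stdAddChar (N := M))‖ / M * ‖∑ d ∈ m.divisors, χ⁻¹ (d : ZMod M)‖
        ≤ 4 * π * ((m : ℝ) + 1) :=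
          mul_le_mul hc hs (norm_nonneg _) (by positivity)
      _ ≤ 4 * π * ((m : ℝ) + 1) ^ 2 := mul_le_mul_of_nonneg_left h2 (by positivity)
      _ ≤ (2 * ‖χ.LFunction 1‖ + 4 * π) * ((m : ℝ) + 1) ^ 2 :=
          mul_le_mul_of_nonneg_right (by linarith) (by positivity)

/-- The `q`-series `Σ b(m) e^{2πimz}` converges absolutely on `ℍ`. [folklore] -/
theorem summable_eisensteinOneZeroCoeff_mul_exp (z : ℍ) :
    Summable fun m : ℕ => eisensteinOneZeroCoeff χ m * Complex.exp (2 * π * Complex.I * m * z) := by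
  refine Summable.of_norm ?_
  refine (summable_norm_mul_exp (norm_eisensteinOneZeroCoeff_le χ) z.im_pos).congr fun m => ?_
  rw [norm_mul]
  congr 1
  rw [show ((z : ℂ)) = (z.re : ℂ) + z.im * Complex.I from (Complex.re_add_im (z : ℂ)).symm,
    cexp_horizontal, norm_mul, norm_cexp_two_pi_mul, mul_one, Complex.norm_real,
    Real.norm_of_nonneg (Real.exp_pos _).le]

/-- **`G̃_χ(·, 0) = qSeries b`** for primitive odd `χ` (the `q`-expansion
`eisensteinOneCont_zero_qExpansion` repackaged as the tree's `qSeries`). [folklore] -/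
theorem eisensteinOneCont_zero_eq_qSeries (hprim : χ.IsPrimitive) (hodd : χ.Odd) (z : ℍ) :
    eisensteinOneCont χ z 0 = qSeries (eisensteinOneZeroCoeff χ) z := by
  unfold qSeries
  rw [(summable_eisensteinOneZeroCoeff_mul_exp χ z).tsum_eq_zero_add,
    eisensteinOneCont_zero_qExpansion χ hprim hodd z]
  have h0 : eisensteinOneZeroCoeff χ 0 * Complex.exp (2 * π * Complex.I * ((0 : ℕ) : ℂ) * z) =
      2 * χ.LFunction 1 := by
    simp [eisensteinOneZeroCoeff]
  have ht : ∀ m : ℕ, eisensteinOneZeroCoeff χ (m + 1) *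
      Complex.exp (2 * π * Complex.I * ((m + 1 : ℕ) : ℂ) * z) =
      -(4 * π * Complex.I * gaussSum χ (ZMod.stdAddChar (N := M)) / M) *
        ((∑ d ∈ (m + 1).divisors, χ⁻¹ (d : ZMod M)) *
          Complex.exp (2 * π * Complex.I * z) ^ (m + 1)) := by
    intro m
    simp only [eisensteinOneZeroCoeff, Nat.succ_ne_zero, if_false]
    rw [← Complex.exp_nat_mul]
    push_cast
    ring_nf
  rw [h0, tsum_congr ht, tsum_mul_left]
  ring

end Coeff

/-! ### Automorphy and parity bookkeeping -/

section Automorphy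

variable {M : ℕ} [NeZero M] (χ : DirichletCharacter ℂ M)

/-- The bottom-right entry of `A ∈ Γ₀(N)` is coprime to `N`. [folklore] -/
theorem isCoprime_apply_one_one_of_mem_Gamma0 {N : ℕ} {A : SL(2, ℤ)} (hA : A ∈ Gamma0 N) :
    IsCoprime (A 1 1 : ℤ) (N : ℤ) := by
  have hdet := A.det_coe
  rw [Matrix.det_fin_two] at hdet
  obtain ⟨c', hc'⟩ : (N : ℤ) ∣ A 1 0 :=
    (ZMod.intCast_zmod_eq_zero_iff_dvd _ _).mp (Gamma0_mem.mp hA)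
  refine ⟨A 0 0, -(A 0 1 * c'), ?_⟩
  rw [hc'] at hdet
  linear_combination hdet

omit [NeZero M] in
/-- `Γ₀(N) ⊆ Γ₀(M)` for `M ∣ N`. [folklore] -/
theorem mem_Gamma0_of_dvd {N : ℕ} (hMN : M ∣ N) {A : SL(2, ℤ)} (hA : A ∈ Gamma0 N) :
    A ∈ Gamma0 M := by
  rw [Gamma0_mem] at hA ⊢
  rw [ZMod.intCast_zmod_eq_zero_iff_dvd] at hA ⊢
  exact dvd_trans (Int.natCast_dvd_natCast.mpr hMN) hA

/-- **`G̃_χ(·, 0)` has weight `1` and character `ψ = χ⁻¹ (mod N)` on `Γ₀(N)`** (`M ∣ N`, odd `χ`):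
`G̃_χ(Aτ, 0) = ψ(d) j(A, τ) G̃_χ(τ, 0)`. [folklore] -/
theorem eisensteinOneCont_zero_smul_of_dvd (hodd : χ.Odd) {N : ℕ} (hMN : M ∣ N) {A : SL(2, ℤ)}
    (hA : A ∈ Gamma0 N) (τ : ℍ) :
    eisensteinOneCont χ (A • τ) 0 =
      (DirichletCharacter.changeLevel hMN χ⁻¹) (A 1 1) * denom A τ * eisensteinOneCont χ τ 0 := by
  have hA' : A ∈ Gamma0 M := mem_Gamma0_of_dvd hMN hA
  have h := eisensteinOneCont_smul χ hodd hA' τ (s := 0)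
    (by simp only [Complex.zero_re]; norm_num)
  have hcop : IsCoprime (A 1 1 : ℤ) (N : ℤ) := isCoprime_apply_one_one_of_mem_Gamma0 hA
  have hcopM : IsCoprime (A 1 1 : ℤ) (M : ℤ) :=
    hcop.of_isCoprime_of_dvd_right (Int.natCast_dvd_natCast.mpr hMN)
  have hψ : (DirichletCharacter.changeLevel hMN χ⁻¹) (A 1 1) = (χ (A 1 1))⁻¹ := by
    rw [DirichletCharacter.changeLevel_eq_cast_of_dvd' _ hMN hcop, MulChar.inv_apply_eq_inv']
  have hne : χ (A 1 1) ≠ 0 := by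
    have hu : IsUnit ((A 1 1 : ℤ) : ZMod M) := (ZMod.coe_int_isUnit_iff_isCoprime _ _).mpr hcopM.symm
    exact (hu.map χ).ne_zero
  rw [hψ]
  calc eisensteinOneCont χ (A • τ) 0
      = (χ (A 1 1))⁻¹ * (χ (A 1 1) * eisensteinOneCont χ (A • τ) 0) := by
        rw [← mul_assoc, inv_mul_cancel₀ hne, one_mul]
    _ = (χ (A 1 1))⁻¹ * (denom A τ * eisensteinOneCont χ τ 0) := by rw [h]
    _ = (χ (A 1 1))⁻¹ * denom A τ * eisensteinOneCont χ τ 0 := by ring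

omit [NeZero M] in
/-- `ψ = χ⁻¹ (mod N)` is odd when `χ` is. [folklore] -/
theorem odd_changeLevel_inv (hodd : χ.Odd) {N : ℕ} (hMN : M ∣ N) :
    (DirichletCharacter.changeLevel hMN χ⁻¹).Odd := by
  unfold DirichletCharacter.Odd at *
  have hcop : IsCoprime (-1 : ℤ) (N : ℤ) := isCoprime_one_left.neg_left
  have h := DirichletCharacter.changeLevel_eq_cast_of_dvd' χ⁻¹ hMN hcop
  push_cast at h
  rw [h, MulChar.inv_apply_eq_inv', hodd]
  norm_num

end Automorphy

/-! ### The assembled Rankin–Selberg identity and its continuation -/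

section Assembly

variable {M : ℕ} [NeZero M] (χ : DirichletCharacter ℂ M)
variable {N : ℕ} [NeZero N] (ψ : DirichletCharacter ℂ N)

variable (g : (↥𝒮ℒ ⧸ (Gamma0 N : Subgroup (GL (Fin 2) ℝ)).subgroupOf 𝒮ℒ) → SL(2, ℤ))
  (hg : ∀ q, (Matrix.SpecialLinearGroup.mapGL ℝ (g q) : GL (Fin 2) ℝ) =
    ((q.out : ↥𝒮ℒ) : GL (Fin 2) ℝ))
variable (γ : {v : Fin 2 → ℤ // IsCoprime (v 0) (v 1) ∧ (N : ℤ) ∣ v 0} → SL(2, ℤ))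
  (hγ : ∀ v, (γ v) 1 0 = v.1 0 ∧ (γ v) 1 1 = v.1 1)
variable [Fintype (↥𝒮ℒ ⧸ (Gamma0 N : Subgroup (GL (Fin 2) ℝ)).subgroupOf 𝒮ℒ)]
include hg hγ

/-- **The Rankin–Selberg identity on `Re s ≫ 0`**: for primitive odd `χ mod M`, `M ∣ N`,
`ψ = χ⁻¹ (mod N)`, `f ∈ S₂(Γ₀(N))`, there is `σ₀` with, for all `Re s > σ₀`,
`∫_F \overline{G̃_ψ(τ, s̄)} f(τ) \overline{G̃_χ(τ, 0)} y² dμ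
  = \overline{L(ψ, 1+2s̄)} · 2Γ(s+1) Σ_{m ≥ 1} a(m) \overline{b(m)} (4πm)^{-(s+1)}`. [folklore] -/
theorem rankinSelberg_eisensteinPair_eq_tsum (hprim : χ.IsPrimitive) (hodd : χ.Odd)
    (hMN : M ∣ N) (hψ : ψ = DirichletCharacter.changeLevel hMN χ⁻¹) (f : CuspForm (Gamma0 N) 2) :
    ∃ σ₀ : ℝ, ∀ s : ℂ, σ₀ < s.re →
      ∫ τ in ⋃ q, {τ : ℍ | g q • τ ∈ 𝒟ᵒ},
          conj (eisensteinOneCont ψ τ (conj s)) *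
            (f τ * conj (eisensteinOneCont χ τ 0) * ((τ.im : ℝ) : ℂ) ^ 2) =
        conj (ψ.LFunction (1 + 2 * conj s)) * (2 * (Complex.Gamma (s + 1) *
          ∑' m : ℕ, cuspCoeff f (m + 1) * conj (eisensteinOneZeroCoeff χ (m + 1)) *
            (1 / ((4 * π * ((m : ℝ) + 1) : ℝ) : ℂ)) ^ (s + 1))) := by
  have hoddψ : ψ.Odd := hψ ▸ odd_changeLevel_inv χ hodd hMN
  -- coefficient bounds with the common exponent `2`
  obtain ⟨Ca, hCa⟩ := exists_norm_cuspCoeff_le f (k := 2) (by norm_num)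
  have ha : ∀ m, ‖cuspCoeff f m‖ ≤ Ca * ((m : ℝ) + 1) ^ 2 := fun m => by simpa using hCa m
  have hb := norm_eisensteinOneZeroCoeff_le χ
  -- growth bounds
  obtain ⟨Cφ, -, hφb⟩ := exists_norm_le_exp_mul f
  obtain ⟨CF, B, -, hB, hFb⟩ := exists_bound_eisensteinOneCont_global_box χ hodd
    (a := -1 / 4) (b := 1 / 4) (T := 1) (by norm_num) (by norm_num) one_pos
  have hFb0 : ∀ τ : ℍ, ‖eisensteinOneCont χ τ 0‖ ≤ CF * (τ.im ^ B + τ.im ^ (-B)) := fun τ =>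
    hFb τ 0 (by simp only [Complex.zero_re]; norm_num) (by simp only [Complex.zero_re]; norm_num)
      (by simp only [Complex.zero_im, abs_zero]; norm_num)
  have hφb' : ∀ τ : ℍ, ‖f τ‖ ≤ Cφ * Real.exp (-(2 * π * τ.im)) * (1 + τ.im ^ (-(((2 : ℤ) : ℝ) / 2))) :=
    hφb
  refine ⟨max 4 (B + ((2 : ℤ) : ℝ) / 2), fun s hs => ?_⟩
  have hs4 : (4 : ℝ) < s.re := lt_of_le_of_lt (le_max_left _ _) hs
  have hsB : B + ((2 : ℤ) : ℝ) / 2 - 1 < s.re := by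
    have := le_max_right 4 (B + ((2 : ℤ) : ℝ) / 2); linarith
  exact integral_domain_conj_eisensteinOneCont_mul_eq_tsum ψ g hg γ hγ hoddψ ha hb
    (cuspCoeff_zero_eq f) (⇑f) (fun τ => eisensteinOneCont χ τ 0) (cuspForm_eq_qSeries f)
    (eisensteinOneCont_zero_eq_qSeries χ hprim hodd) (measurable_cuspForm f)
    (measurable_eisensteinOneCont χ hodd (s := 0) (by simp only [Complex.zero_re]; norm_num))
    (fun A hA τ => cuspForm_smul_eq_denom_sq_mul f hA τ)
    (fun A hA τ => by rw [hψ]; exact eisensteinOneCont_zero_smul_of_dvd χ hodd hMN hA τ)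
    hB (by norm_num) hφb' hFb0 (by linarith) (by push_cast; linarith) hsB

/-- **`J` continues the Dirichlet series to `Re s > -1/2`**: any function holomorphic on
`Re s > -1/2` that agrees with `\overline{L(ψ, 1+2s̄)} · 2Γ(s+1) Σ a(m) \overline{b(m)} (4πm)^{-(s+1)}`
for `Re s` large coincides there with the Rankin–Selberg integral
`J(s) = ∫_F \overline{G̃_ψ(τ, s̄)} f \overline{G̃_χ(τ, 0)} y² dμ` (identity theorem; `J` is
holomorphic by `differentiableOn_rsIntegral_eisensteinOneCont_pair`). [folklore] -/
theorem rankinSelberg_eisensteinPair_continuation (hprim : χ.IsPrimitive) (hodd : χ.Odd)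
    (hMN : M ∣ N) (hψ : ψ = DirichletCharacter.changeLevel hMN χ⁻¹) (f : CuspForm (Gamma0 N) 2) :
    ∃ σ₀ : ℝ, ∀ G : ℂ → ℂ, DifferentiableOn ℂ G {s : ℂ | -1 / 2 < s.re} →
      (∀ s : ℂ, σ₀ < s.re → G s =
        conj (ψ.LFunction (1 + 2 * conj s)) * (2 * (Complex.Gamma (s + 1) *
          ∑' m : ℕ, cuspCoeff f (m + 1) * conj (eisensteinOneZeroCoeff χ (m + 1)) *
            (1 / ((4 * π * ((m : ℝ) + 1) : ℝ) : ℂ)) ^ (s + 1)))) →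
      ∀ s : ℂ, -1 / 2 < s.re → G s =
        ∫ τ in ⋃ q, {τ : ℍ | g q • τ ∈ 𝒟ᵒ},
          conj (eisensteinOneCont ψ τ (conj s)) *
            (f τ * conj (eisensteinOneCont χ τ 0) * ((τ.im : ℝ) : ℂ) ^ 2) := by
  have hoddψ : ψ.Odd := hψ ▸ odd_changeLevel_inv χ hodd hMN
  obtain ⟨σ₀, hσ₀⟩ := rankinSelberg_eisensteinPair_eq_tsum χ ψ g hg γ hγ hprim hodd hMN hψ f
  refine ⟨max σ₀ 0, fun G hG hGeq s hs => ?_⟩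
  set U : Set ℂ := {s : ℂ | -1 / 2 < s.re} with hU
  have hUo : IsOpen U := isOpen_lt continuous_const Complex.continuous_re
  have hUc : IsPreconnected U := (convex_halfSpace_re_gt (-1 / 2)).isPreconnected
  set J : ℂ → ℂ := fun s => ∫ τ in ⋃ q, {τ : ℍ | g q • τ ∈ 𝒟ᵒ},
      conj (eisensteinOneCont ψ τ (conj s)) *
        (f τ * conj (eisensteinOneCont χ τ 0) * ((τ.im : ℝ) : ℂ) ^ 2) with hJ
  have hJd : DifferentiableOn ℂ J U :=
    differentiableOn_rsIntegral_eisensteinOneCont_pair g f χ hodd ψ hoddψ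
  have hFd : DifferentiableOn ℂ (fun s => G s - J s) U := hG.sub hJd
  have hFa : AnalyticOnNhd ℂ (fun s => G s - J s) U := hFd.analyticOnNhd hUo
  -- the two functions agree on the open half-plane `Re s > max σ₀ 0 + 1 =: c`, around `c + 1`
  set c : ℝ := max σ₀ 0 + 1 with hc
  have hz₀ : ((c + 1 : ℝ) : ℂ) ∈ U := by
    simp only [hU, mem_setOf_eq, Complex.ofReal_re, hc]
    have := le_max_right σ₀ 0; linarith
  have hV : {s : ℂ | c < s.re} ∈ 𝓝 (((c + 1 : ℝ) : ℂ)) :=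
    (isOpen_lt continuous_const Complex.continuous_re).mem_nhds (by
      simp only [mem_setOf_eq, Complex.ofReal_re]; linarith)
  have hF0 : (fun s => G s - J s) =ᶠ[𝓝 (((c + 1 : ℝ) : ℂ))] 0 := by
    filter_upwards [hV] with t ht
    have htσ : σ₀ < t.re := by
      have := le_max_left σ₀ 0
      simp only [hc] at ht; linarith
    simp only [Pi.zero_apply, hJ]
    rw [hGeq t (lt_of_le_of_lt (by simp [hc]) ht), hσ₀ t htσ, sub_self]
  have h := hFa.eqOn_zero_of_preconnected_of_eventuallyEq_zero hUc hz₀ hF0 hs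
  exact sub_eq_zero.mp h

/-- **The value at `s = 0`**: with `G` as above,
`G(0) = ∫_F \overline{G̃_ψ(τ, 0)} f(τ) \overline{G̃_χ(τ, 0)} (Im τ)² dμ`. [folklore] -/
theorem rankinSelberg_eisensteinPair_zero (hprim : χ.IsPrimitive) (hodd : χ.Odd)
    (hMN : M ∣ N) (hψ : ψ = DirichletCharacter.changeLevel hMN χ⁻¹) (f : CuspForm (Gamma0 N) 2) :
    ∃ σ₀ : ℝ, ∀ G : ℂ → ℂ, DifferentiableOn ℂ G {s : ℂ | -1 / 2 < s.re} →
      (∀ s : ℂ, σ₀ < s.re → G s =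
        conj (ψ.LFunction (1 + 2 * conj s)) * (2 * (Complex.Gamma (s + 1) *
          ∑' m : ℕ, cuspCoeff f (m + 1) * conj (eisensteinOneZeroCoeff χ (m + 1)) *
            (1 / ((4 * π * ((m : ℝ) + 1) : ℝ) : ℂ)) ^ (s + 1)))) →
      G 0 = ∫ τ in ⋃ q, {τ : ℍ | g q • τ ∈ 𝒟ᵒ},
          conj (eisensteinOneCont ψ τ 0) *
            (f τ * conj (eisensteinOneCont χ τ 0) * ((τ.im : ℝ) : ℂ) ^ 2) := by
  obtain ⟨σ₀, hσ₀⟩ := rankinSelberg_eisensteinPair_continuation χ ψ g hg γ hγ hprim hodd hMN hψ f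
  refine ⟨σ₀, fun G hG hGeq => ?_⟩
  have h := hσ₀ G hG hGeq 0 (by simp only [Complex.zero_re]; norm_num)
  simpa using h

end Assembly

end Literature.NumberTheory.EllipticCurves.ModularForms
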